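import Literature.Analysis.FluidPDE.ElgindiSharpHardy
import Literature.Analysis.FluidPDE.ElgindiAngularOperatorExpansion
import Literature.Analysis.FluidPDE.ElgindiTransportL2Coercivity
import Mathlib.Analysis.Calculus.IteratedDeriv.Lemmas
import Mathlib.Algebra.Order.Chebyshev
import HarnessLib

/-!
# Division by `sin 2θ` in the angular weights of `𝓗⁴` ([Elgindi2021] §8.5 Proposition 8.21 with
Lemma 8.23): the one-variable core

Topic `Literature/Analysis/FluidPDE`. Support file (one definition with body — the weighted square
integral `wsq` — and proved theorems, no named facts) on the proof path of the named fact
`Literature.Analysis.FluidPDE.Elgindi.ElgindiGhoulMasmoudi2021_stabilityCore`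
(`ElgindiStabilityDecomposition.lean`). T. M. Elgindi, Ann. of Math. 194 (2021) =
arXiv:1904.04795, §8.5 Proposition 8.21 (p. 28): "`|Φ/sin 2θ|_{𝓗⁴} ≤ C|∂_θΦ|_{𝓗⁴}` … The proof
directly follows from two lemmas. The first, Lemma (SharpHardyInequality1), has already been
established and the second is a variant on Lemma (HardyInequality2)": Lemma 8.23 (p. 29),
`∫₀^∞ x^{2k−γ}(∂ₓᵏ(f/x))² ≤ ∫₀^∞ x^{2k−γ}(∂ₓ^{k+1}f)²`, proved by the multiplier `x^{2k−γ}∂ₓᵏ(f/x)`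
against `∂ₓ^{k+1}f = x∂ₓ^{k+1}h + (k+1)∂ₓᵏh` (`h = f/x`).

This file proves the ANGULAR (two-ended, `x ↝ sin 2θ` on `(0, π/2)`) version of Lemma 8.23 and
assembles the one-variable core of Proposition 8.21 in the `D_θ`-words of the tree's `𝓗⁴` norm.
We parametrise by the quotient: `g ∈ C^∞(ℝ)` and `f = sin 2θ·g` (so `f(0) = f(π/2) = 0`,
`g = f/sin 2θ` on `(0, π/2)`); `S = sin 2θ`, `1 < γ ≤ 11/10` (the tree's `γ = 1 + α/10`, `α ≤ 1`),
`η = 99/100`.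
* `wsq q u = ∫_{(0,π/2)} S^q u²` (weighted square integral);
* **Lemma 8.23, angular form** (`wsq_iteratedDeriv_le`): for `k ≥ 1`,
  `∫ S^{2k−γ}(g⁽ᵏ⁾)² ≤ 2∫ S^{2k−γ}(f⁽ᵏ⁺¹⁾)² + c_k Σ_{m<k} ∫ S^{2k−γ}(g⁽ᵐ⁾)²`: the multiplier
  `S^{2k−γ}cos 2θ·g⁽ᵏ⁾` against the Leibniz expansion `f⁽ᵏ⁺¹⁾ = Sg⁽ᵏ⁺¹⁾ + 2(k+1)cos 2θ·g⁽ᵏ⁾ + R_k`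
  produces `(1+γ)∫S^{2k−γ}cos²2θ(g⁽ᵏ⁾)² + ∫S^{2k+2−γ}(g⁽ᵏ⁾)²` (the printed `(1 + γ/2)` in the variable
  `x`), whence `T ≤ √T(√Y + √Z)`;
* **the core of Proposition 8.21** (`divisionBySin_core`):
  `Σ_{i=1}^4 ∫(D_θⁱg)²S^{−γ} ≤ K·(Σ_{i=1}^4 ∫(D_θⁱf′)²S^{−γ} + ∫f′²S^{−η})` with a universal `K`, via the
  up/down comparisons `D_θⁱ ↔ Sᵐ∂ᵐ` of `ElgindiAngularOperatorExpansion`, and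
  `∫g²S^{−η} ≤ ∫f′²S^{−η}` (the sharp Hardy inequality, `ElgindiSharpHardy`).
The strip version (`|Φ/sin 2θ|_{𝓗⁴} ≤ C|∂_θΦ|_{𝓗⁴}`) is assembled from these slice inequalities in
`ElgindiDivisionBySinStrip.lean`.
-/

noncomputable section

open Set Real MeasureTheory intervalIntegral Finset
open _root_.Topology
open scoped ContDiff

namespace Literature.Analysis.FluidPDE

namespace Elgindi

/-- Finite differentiability orders are below `∞` (private copy of a landed one-liner of
`KNSSThm52Assembly`, not worth the import). [folklore] -/
private theorem natCast_le_infty (m : ℕ) : (m : WithTop ℕ∞) ≤ ∞ := WithTop.coe_le_coe.2 le_top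

/-- `1 ≤ ∞` among differentiability orders (private copy of a landed one-liner). [folklore] -/
private theorem one_le_infty : (1 : WithTop ℕ∞) ≤ ∞ := WithTop.coe_le_coe.2 le_top

/-- Finite differentiability orders are strictly below `∞`. [folklore] -/
private theorem natCast_lt_infty (m : ℕ) : (m : WithTop ℕ∞) < ∞ := WithTop.coe_lt_coe.2 (ENat.coe_lt_top m)

/-! ### Iterated derivatives of `sin`, `cos`, `sin 2θ` -/

/-- `|sin⁽ⁿ⁾| ≤ 1` and `|cos⁽ⁿ⁾| ≤ 1`. [folklore] -/
theorem abs_iteratedDeriv_sin_cos_le (n : ℕ) (x : ℝ) :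
    |iteratedDeriv n Real.sin x| ≤ 1 ∧ |iteratedDeriv n Real.cos x| ≤ 1 := by
  induction n generalizing x with
  | zero => simpa using ⟨Real.abs_sin_le_one x, Real.abs_cos_le_one x⟩
  | succ n ih =>
    rw [Real.iteratedDeriv_add_one_sin, Real.iteratedDeriv_add_one_cos]
    refine ⟨(ih x).2, ?_⟩
    rw [Pi.neg_apply, abs_neg]; exact (ih x).1

/-- `(sin 2θ)⁽ⁿ⁾ = 2ⁿ sin⁽ⁿ⁾(2θ)`. [folklore] -/
theorem iteratedDeriv_sin_two_mul (n : ℕ) (θ : ℝ) :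
    iteratedDeriv n (fun x => Real.sin (2 * x)) θ = 2 ^ n * iteratedDeriv n Real.sin (2 * θ) := by
  have h := iteratedDeriv_comp_const_mul (n := n) (Real.contDiff_sin.of_le le_top) (2 : ℝ)
  exact congrFun h θ

/-- `|(sin 2θ)⁽ⁿ⁾| ≤ 2ⁿ`. [folklore] -/
theorem abs_iteratedDeriv_sin_two_mul_le (n : ℕ) (θ : ℝ) :
    |iteratedDeriv n (fun x => Real.sin (2 * x)) θ| ≤ 2 ^ n := by
  rw [iteratedDeriv_sin_two_mul, abs_mul, abs_of_nonneg (by positivity : (0:ℝ) ≤ 2 ^ n)]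
  exact mul_le_of_le_one_right (by positivity) (abs_iteratedDeriv_sin_cos_le n _).1

/-- `(sin 2θ)′ = 2cos 2θ` as an iterated derivative. [folklore] -/
theorem iteratedDeriv_one_sin_two_mul (θ : ℝ) :
    iteratedDeriv 1 (fun x => Real.sin (2 * x)) θ = 2 * Real.cos (2 * θ) := by
  rw [iteratedDeriv_sin_two_mul, iteratedDeriv_one, Real.deriv_sin, pow_one]

/-- `sin 2θ` is smooth. [folklore] -/
theorem contDiff_sin_two_mul {n : WithTop ℕ∞} : ContDiff ℝ n fun x : ℝ => Real.sin (2 * x) :=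
  Real.contDiff_sin.comp (contDiff_const.mul contDiff_id)

/-! ### The Leibniz expansion of `(sin 2θ·g)⁽ᵏ⁺¹⁾` -/

/-- The remainder of the Leibniz expansion: `R_k = Σ_{2 ≤ i ≤ k+1} C(k+1,i)(sin 2θ)⁽ⁱ⁾g⁽ᵏ⁺¹⁻ⁱ⁾`. [folklore] -/
def leibnizRem (k : ℕ) (g : ℝ → ℝ) (θ : ℝ) : ℝ :=
  ∑ i ∈ range k, ((k + 1).choose (i + 2) : ℝ) * iteratedDeriv (i + 2) (fun x => Real.sin (2 * x)) θ *
    iteratedDeriv (k - 1 - i) g θ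

/-- **Leibniz**: `(Sg)⁽ᵏ⁺¹⁾ = S·g⁽ᵏ⁺¹⁾ + 2(k+1)cos 2θ·g⁽ᵏ⁾ + R_k` for `k ≥ 1`. [folklore] -/
theorem iteratedDeriv_sin_mul (k : ℕ) (hk : 1 ≤ k) {g : ℝ → ℝ} (hg : ContDiff ℝ ∞ g) (θ : ℝ) :
    iteratedDeriv (k + 1) (fun x => Real.sin (2 * x) * g x) θ =
      Real.sin (2 * θ) * iteratedDeriv (k + 1) g θ + 2 * (k + 1) * Real.cos (2 * θ) * iteratedDeriv k g θ +
        leibnizRem k g θ := by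
  obtain ⟨n, rfl⟩ : ∃ n, k = n + 1 := ⟨k - 1, by omega⟩
  have hS : ContDiffAt ℝ (n + 1 + 1 : ℕ) (fun x : ℝ => Real.sin (2 * x)) θ := contDiff_sin_two_mul.contDiffAt
  have hG : ContDiffAt ℝ (n + 1 + 1 : ℕ) g θ := (hg.of_le (by exact_mod_cast le_top)).contDiffAt
  have h := iteratedDeriv_mul hS hG
  have e : ((fun x : ℝ => Real.sin (2 * x)) * g) = fun x => Real.sin (2 * x) * g x := rfl
  rw [e] at h
  rw [h, Finset.sum_range_succ', Finset.sum_range_succ']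
  unfold leibnizRem
  have hsub : ∀ i ∈ range (n + 1), ((n + 1 + 1).choose (i + 1 + 1) : ℝ) * iteratedDeriv (i + 1 + 1) (fun x => Real.sin (2 * x)) θ *
      iteratedDeriv (n + 1 + 1 - (i + 1 + 1)) g θ =
      ((n + 1 + 1).choose (i + 2) : ℝ) * iteratedDeriv (i + 2) (fun x => Real.sin (2 * x)) θ * iteratedDeriv (n + 1 - 1 - i) g θ := by
    intro i _
    have : n + 1 + 1 - (i + 1 + 1) = n + 1 - 1 - i := by omega
    rw [this]
  rw [Finset.sum_congr rfl hsub]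
  simp only [Nat.choose_zero_right, Nat.cast_one, one_mul, iteratedDeriv_zero, Nat.sub_zero, zero_add, Nat.choose_one_right,
    iteratedDeriv_one_sin_two_mul, show n + 1 + 1 - 1 = n + 1 by omega]
  push_cast
  ring

/-- The remainder is bounded by the lower derivatives: `|R_k| ≤ 4ᵏ⁺¹ Σ_{m<k} |g⁽ᵐ⁾|`. [folklore] -/
theorem abs_leibnizRem_le (k : ℕ) (g : ℝ → ℝ) (θ : ℝ) :
    |leibnizRem k g θ| ≤ 4 ^ (k + 1) * ∑ m ∈ range k, |iteratedDeriv m g θ| := by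
  unfold leibnizRem
  refine (Finset.abs_sum_le_sum_abs _ _).trans ?_
  -- reindex the target sum by `m = k - 1 - i`
  have hre : ∑ m ∈ range k, |iteratedDeriv m g θ| = ∑ i ∈ range k, |iteratedDeriv (k - 1 - i) g θ| := by
    rw [← Finset.sum_range_reflect]
  rw [hre, Finset.mul_sum]
  refine Finset.sum_le_sum fun i hi => ?_
  rw [Finset.mem_range] at hi
  rw [abs_mul, abs_mul]
  have h1 : |((k + 1).choose (i + 2) : ℝ)| ≤ 2 ^ (k + 1) := by
    rw [Nat.abs_cast]
    exact_mod_cast Nat.choose_le_two_pow (k + 1) (i + 2)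
  have h2 : |iteratedDeriv (i + 2) (fun x => Real.sin (2 * x)) θ| ≤ 2 ^ (k + 1) :=
    (abs_iteratedDeriv_sin_two_mul_le _ _).trans (pow_le_pow_right₀ (by norm_num) (by omega))
  have h4 : (4 : ℝ) ^ (k + 1) = 2 ^ (k + 1) * 2 ^ (k + 1) := by rw [← mul_pow]; norm_num
  rw [h4]
  have ha := abs_nonneg (iteratedDeriv (k - 1 - i) g θ)
  calc |((k + 1).choose (i + 2) : ℝ)| * |iteratedDeriv (i + 2) (fun x => Real.sin (2 * x)) θ| * |iteratedDeriv (k - 1 - i) g θ|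
      ≤ 2 ^ (k + 1) * 2 ^ (k + 1) * |iteratedDeriv (k - 1 - i) g θ| := by
        refine mul_le_mul_of_nonneg_right ?_ ha
        exact mul_le_mul h1 h2 (abs_nonneg _) (by positivity)

/-- `R_k² ≤ 16ᵏ⁺¹·k·Σ_{m<k} (g⁽ᵐ⁾)²`. [folklore] -/
theorem sq_leibnizRem_le (k : ℕ) (g : ℝ → ℝ) (θ : ℝ) :
    leibnizRem k g θ ^ 2 ≤ 16 ^ (k + 1) * k * ∑ m ∈ range k, iteratedDeriv m g θ ^ 2 := by
  have h := abs_leibnizRem_le k g θ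
  have hcs : (∑ m ∈ range k, |iteratedDeriv m g θ|) ^ 2 ≤ k * ∑ m ∈ range k, |iteratedDeriv m g θ| ^ 2 := by
    have := sq_sum_le_card_mul_sum_sq (s := range k) (f := fun m => |iteratedDeriv m g θ|)
    simpa using this
  simp only [sq_abs] at hcs
  have h0 : 0 ≤ ∑ m ∈ range k, |iteratedDeriv m g θ| := Finset.sum_nonneg fun _ _ => abs_nonneg _
  calc leibnizRem k g θ ^ 2 = |leibnizRem k g θ| ^ 2 := (sq_abs _).symm
    _ ≤ (4 ^ (k + 1) * ∑ m ∈ range k, |iteratedDeriv m g θ|) ^ 2 := pow_le_pow_left₀ (abs_nonneg _) h 2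
    _ = 16 ^ (k + 1) * (∑ m ∈ range k, |iteratedDeriv m g θ|) ^ 2 := by
        rw [mul_pow, ← pow_mul, show (4:ℝ) ^ ((k + 1) * 2) = 16 ^ (k + 1) by rw [mul_comm, pow_mul]; norm_num]
    _ ≤ 16 ^ (k + 1) * (k * ∑ m ∈ range k, iteratedDeriv m g θ ^ 2) := mul_le_mul_of_nonneg_left hcs (by positivity)
    _ = _ := by ring

/-- The remainder is continuous. [folklore] -/
theorem continuous_leibnizRem (k : ℕ) {g : ℝ → ℝ} (hg : ContDiff ℝ ∞ g) : Continuous (leibnizRem k g) := by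
  unfold leibnizRem
  refine continuous_finsetSum _ fun i _ => ?_
  exact (continuous_const.mul ((contDiff_sin_two_mul (n := ∞)).continuous_iteratedDeriv (i + 2) (natCast_le_infty _))).mul
    (hg.continuous_iteratedDeriv (k - 1 - i) (natCast_le_infty _))

/-! ### Weighted square integrals on the quarter period -/

/-- `sin 2θ > 0` on `(0, π/2)`. [folklore] -/
theorem sin_two_mul_pos_of_mem {θ : ℝ} (hθ : θ ∈ Ioo 0 (π / 2)) : 0 < Real.sin (2 * θ) :=
  Real.sin_pos_of_pos_of_lt_pi (by linarith [hθ.1]) (by linarith [hθ.2])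

/-- `sin 2θ ≤ 1`. [folklore] -/
theorem sin_two_mul_le_one' (θ : ℝ) : Real.sin (2 * θ) ≤ 1 := Real.sin_le_one _

/-- **The weighted square integral** `wsq q u = ∫_{(0,π/2)} u²·sin(2θ)^q`. [folklore] -/
def wsq (q : ℝ) (u : ℝ → ℝ) : ℝ := ∫ θ in Ioo 0 (π / 2), u θ ^ 2 * Real.sin (2 * θ) ^ q

/-- `wsq q u ≥ 0`. [folklore] -/
theorem wsq_nonneg (q : ℝ) (u : ℝ → ℝ) : 0 ≤ wsq q u :=
  setIntegral_nonneg measurableSet_Ioo fun _ hθ => mul_nonneg (sq_nonneg _) (Real.rpow_nonneg (sin_two_mul_pos_of_mem hθ).le _)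

/-- `θ ↦ sin(2θ)^q` is continuous for `q ≥ 0` (a private copy of the lemma of
`ElgindiAngularLevelIBP`, not imported here). [folklore] -/
private theorem continuous_sin2_rpow {q : ℝ} (hq : 0 ≤ q) : Continuous fun θ : ℝ => Real.sin (2 * θ) ^ q :=
  (Real.continuous_sin.comp (continuous_const.mul continuous_id)).rpow_const fun _ => Or.inr hq

/-- A continuous function is integrable on `(0, π/2)`. [folklore] -/
theorem integrableOn_Ioo_of_continuous {u : ℝ → ℝ} (hu : Continuous u) : IntegrableOn u (Ioo 0 (π / 2)) :=
  (hu.integrableOn_Icc (a := 0) (b := π / 2)).mono_set Ioo_subset_Icc_self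

/-- The `wsq q` integrand of a continuous function is integrable for `q ≥ 0`. [folklore] -/
theorem integrableOn_sq_mul_sin_rpow {q : ℝ} (hq : 0 ≤ q) {u : ℝ → ℝ} (hu : Continuous u) :
    IntegrableOn (fun θ => u θ ^ 2 * Real.sin (2 * θ) ^ q) (Ioo 0 (π / 2)) :=
  integrableOn_Ioo_of_continuous ((hu.pow 2).mul (continuous_sin2_rpow hq))

/-- **Monotonicity in the exponent**: `wsq q u ≤ wsq q' u` for `q' ≤ q` (`sin 2θ ≤ 1`), provided
the larger integrand is integrable. [folklore] -/
theorem wsq_mono_exponent {q q' : ℝ} (hqq : q' ≤ q) {u : ℝ → ℝ} (hu : Continuous u)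
    (hint : IntegrableOn (fun θ => u θ ^ 2 * Real.sin (2 * θ) ^ q') (Ioo 0 (π / 2))) : wsq q u ≤ wsq q' u := by
  unfold wsq
  refine setIntegral_mono_on ?_ hint measurableSet_Ioo fun θ hθ => ?_
  · refine Integrable.mono' hint ?_ ?_
    · exact ((hu.measurable.pow_const 2).mul ((Real.continuous_sin.measurable.comp (measurable_const.mul measurable_id)).pow_const q)).aestronglyMeasurable
    · rw [ae_restrict_iff' measurableSet_Ioo]
      refine Filter.Eventually.of_forall fun θ hθ => ?_
      have hs := sin_two_mul_pos_of_mem hθ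
      rw [Real.norm_eq_abs, abs_of_nonneg (mul_nonneg (sq_nonneg _) (Real.rpow_nonneg hs.le _))]
      exact mul_le_mul_of_nonneg_left (Real.rpow_le_rpow_of_exponent_ge hs (sin_two_mul_le_one' θ) hqq) (sq_nonneg _)
  · exact mul_le_mul_of_nonneg_left (Real.rpow_le_rpow_of_exponent_ge (sin_two_mul_pos_of_mem hθ) (sin_two_mul_le_one' θ) hqq) (sq_nonneg _)

/-- `wsq` is even in `u` pointwise: it only depends on `u²` on `(0, π/2)`. [folklore] -/
theorem wsq_congr {q : ℝ} {u v : ℝ → ℝ} (h : ∀ θ ∈ Ioo 0 (π / 2), u θ ^ 2 = v θ ^ 2) : wsq q u = wsq q v :=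
  setIntegral_congr_fun measurableSet_Ioo fun θ hθ => by rw [h θ hθ]

/-- Pointwise domination `u² ≤ c·v²` on `(0,π/2)` gives `wsq q u ≤ c·wsq q v` (`v`-integrand integrable). [folklore] -/
theorem wsq_le_const_mul {q c : ℝ} {u v : ℝ → ℝ} (hu : Measurable u) (hv : IntegrableOn (fun θ => v θ ^ 2 * Real.sin (2 * θ) ^ q) (Ioo 0 (π / 2)))
    (h : ∀ θ ∈ Ioo 0 (π / 2), u θ ^ 2 ≤ c * v θ ^ 2) : wsq q u ≤ c * wsq q v := by
  unfold wsq
  rw [← MeasureTheory.integral_const_mul]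
  have hint' : IntegrableOn (fun θ => c * (v θ ^ 2 * Real.sin (2 * θ) ^ q)) (Ioo 0 (π / 2)) := hv.const_mul c
  refine setIntegral_mono_on ?_ hint' measurableSet_Ioo fun θ hθ => ?_
  · refine Integrable.mono' hint' ?_ ?_
    · exact ((hu.pow_const 2).mul ((Real.continuous_sin.measurable.comp (measurable_const.mul measurable_id)).pow_const q)).aestronglyMeasurable
    · rw [ae_restrict_iff' measurableSet_Ioo]
      refine Filter.Eventually.of_forall fun θ hθ => ?_
      have hs := Real.rpow_nonneg (sin_two_mul_pos_of_mem hθ).le q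
      rw [Real.norm_eq_abs, abs_of_nonneg (mul_nonneg (sq_nonneg _) hs), ← mul_assoc]
      exact mul_le_mul_of_nonneg_right (h θ hθ) hs
  · rw [← mul_assoc]
    exact mul_le_mul_of_nonneg_right (h θ hθ) (Real.rpow_nonneg (sin_two_mul_pos_of_mem hθ).le q)

/-! ### The integration by parts of Lemma 8.23 -/

/-- `(sin 2θ)′ = 2cos 2θ`. [folklore] -/
theorem hasDerivAt_sin_two_mul (θ : ℝ) : HasDerivAt (fun x => Real.sin (2 * x)) (2 * Real.cos (2 * θ)) θ := by
  have h2 : HasDerivAt (fun x : ℝ => 2 * x) 2 θ := by simpa using (hasDerivAt_id' θ).const_mul (2 : ℝ)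
  simpa [mul_comm] using h2.sin

/-- `(cos 2θ)′ = −2sin 2θ`. [folklore] -/
theorem hasDerivAt_cos_two_mul (θ : ℝ) : HasDerivAt (fun x => Real.cos (2 * x)) (-(2 * Real.sin (2 * θ))) θ := by
  have h2 : HasDerivAt (fun x : ℝ => 2 * x) 2 θ := by simpa using (hasDerivAt_id' θ).const_mul (2 : ℝ)
  simpa [mul_comm] using h2.cos

/-- **Integration by parts** with the multiplier `sin(2θ)^p cos 2θ`, `p ≥ 1`, for `a ∈ C¹`:
`∫ S^p cos·a a′ = −p∫ S^{p−1}cos²·a² + ∫ S^p S·a²` (the boundary terms vanish since `S = 0` at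
both ends). [cite: Elgindi2021, §8.5 proof of Lemma 8.23 (p. 29 of arXiv:1904.04795)] -/
theorem integral_sin_rpow_cos_mul_mul_deriv {p : ℝ} (hp : 1 ≤ p) {a a' : ℝ → ℝ} (ha : Continuous a) (ha' : Continuous a')
    (hd : ∀ θ, HasDerivAt a (a' θ) θ) :
    ∫ θ in Ioo 0 (π / 2), Real.sin (2 * θ) ^ p * Real.cos (2 * θ) * a θ * a' θ =
      -p * (∫ θ in Ioo 0 (π / 2), Real.sin (2 * θ) ^ (p - 1) * Real.cos (2 * θ) ^ 2 * a θ ^ 2) +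
        ∫ θ in Ioo 0 (π / 2), Real.sin (2 * θ) ^ p * Real.sin (2 * θ) * a θ ^ 2 := by
  have hb : (0 : ℝ) ≤ π / 2 := by positivity
  set u : ℝ → ℝ := fun θ => Real.sin (2 * θ) ^ p * Real.cos (2 * θ) with hu
  set u' : ℝ → ℝ := fun θ => 2 * Real.cos (2 * θ) * p * Real.sin (2 * θ) ^ (p - 1) * Real.cos (2 * θ) +
    Real.sin (2 * θ) ^ p * (-(2 * Real.sin (2 * θ))) with hu'
  have hdu : ∀ θ, HasDerivAt u (u' θ) θ := fun θ =>
    ((hasDerivAt_sin_two_mul θ).rpow_const (Or.inr hp)).mul (hasDerivAt_cos_two_mul θ)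
  have hdv : ∀ θ, HasDerivAt (fun x => a x ^ 2) (2 * a θ * a' θ) θ := fun θ => by
    have h := (hd θ).mul (hd θ)
    have e1 : (fun x => a x ^ 2) = fun x => a x * a x := funext fun x => sq (a x)
    rw [e1]; exact h.congr_deriv (by ring)
  have hcS : Continuous fun θ : ℝ => Real.sin (2 * θ) := Real.continuous_sin.comp (continuous_const.mul continuous_id)
  have hcC : Continuous fun θ : ℝ => Real.cos (2 * θ) := Real.continuous_cos.comp (continuous_const.mul continuous_id)
  have hcu' : Continuous u' :=
    ((((continuous_const.mul hcC).mul continuous_const).mul (continuous_sin2_rpow (by linarith))).mul hcC).add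
      ((continuous_sin2_rpow (by linarith)).mul (continuous_const.mul hcS).neg)
  have hcv' : Continuous fun θ => 2 * a θ * a' θ := (continuous_const.mul ha).mul ha'
  have hibp := intervalIntegral.integral_mul_deriv_eq_deriv_mul (a := 0) (b := π / 2) (u := u) (v := fun x => a x ^ 2)
    (fun θ _ => hdu θ) (fun θ _ => hdv θ) (hcu'.intervalIntegrable _ _) (hcv'.intervalIntegrable _ _)
  have hu0 : u 0 = 0 := by
    simp only [hu, mul_zero, Real.sin_zero, Real.zero_rpow (by linarith : p ≠ 0), zero_mul]
  have hu1 : u (π / 2) = 0 := by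
    simp only [hu, show 2 * (π / 2) = π by ring, Real.sin_pi, Real.zero_rpow (by linarith : p ≠ 0), zero_mul]
  rw [hu0, hu1, zero_mul, zero_mul, sub_zero, zero_sub, intervalIntegral.integral_of_le hb, intervalIntegral.integral_of_le hb,
    integral_Ioc_eq_integral_Ioo, integral_Ioc_eq_integral_Ioo] at hibp
  -- `∫ u·(2aa′) = −∫ u′ a²`
  have hl : ∫ θ in Ioo 0 (π / 2), Real.sin (2 * θ) ^ p * Real.cos (2 * θ) * a θ * a' θ =
      (1 / 2) * ∫ θ in Ioo 0 (π / 2), u θ * (2 * a θ * a' θ) := by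
    rw [← MeasureTheory.integral_const_mul]; refine setIntegral_congr_fun measurableSet_Ioo fun θ _ => ?_; simp only [hu]; ring
  have i1 : IntegrableOn (fun θ => Real.sin (2 * θ) ^ (p - 1) * Real.cos (2 * θ) ^ 2 * a θ ^ 2) (Ioo 0 (π / 2)) :=
    integrableOn_Ioo_of_continuous (((continuous_sin2_rpow (by linarith)).mul (hcC.pow 2)).mul (ha.pow 2))
  have i2 : IntegrableOn (fun θ => Real.sin (2 * θ) ^ p * Real.sin (2 * θ) * a θ ^ 2) (Ioo 0 (π / 2)) :=
    integrableOn_Ioo_of_continuous (((continuous_sin2_rpow (by linarith)).mul hcS).mul (ha.pow 2))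
  have hr : ∫ θ in Ioo 0 (π / 2), u' θ * a θ ^ 2 =
      2 * (p * (∫ θ in Ioo 0 (π / 2), Real.sin (2 * θ) ^ (p - 1) * Real.cos (2 * θ) ^ 2 * a θ ^ 2) -
        ∫ θ in Ioo 0 (π / 2), Real.sin (2 * θ) ^ p * Real.sin (2 * θ) * a θ ^ 2) := by
    rw [← MeasureTheory.integral_const_mul, ← integral_sub (i1.const_mul p) i2, ← MeasureTheory.integral_const_mul]
    refine setIntegral_congr_fun measurableSet_Ioo fun θ _ => ?_
    simp only [hu']; ring
  rw [hl, hibp, hr]; ring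


/-! ### Lemma 8.23 in the angular variable -/

/-- **Weighted Cauchy–Schwarz on `(0, π/2)`**: `|∫ u v w S^q| ≤ √(wsq q u)·√(wsq q v)` for continuous
`u, v, w` with `|w| ≤ 1` and `q ≥ 0`. [folklore] -/
theorem abs_integral_mul_mul_sin_rpow_le {q : ℝ} (hq : 0 ≤ q) {u v w : ℝ → ℝ} (hu : Continuous u) (hv : Continuous v)
    (hw : Continuous w) (hw1 : ∀ θ, |w θ| ≤ 1) :
    |∫ θ in Ioo 0 (π / 2), u θ * v θ * w θ * Real.sin (2 * θ) ^ q| ≤ Real.sqrt (wsq q u) * Real.sqrt (wsq q v) := by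
  set φ : ℝ → ℝ := fun θ => u θ * Real.sqrt (Real.sin (2 * θ) ^ q) with hφ
  set ψ : ℝ → ℝ := fun θ => v θ * w θ * Real.sqrt (Real.sin (2 * θ) ^ q) with hψ
  have hcr : Continuous fun θ => Real.sqrt (Real.sin (2 * θ) ^ q) := (continuous_sin2_rpow hq).sqrt
  have hφc : Continuous φ := hu.mul hcr
  have hψc : Continuous ψ := (hv.mul hw).mul hcr
  have hsq : ∀ θ ∈ Ioo (0:ℝ) (π / 2), Real.sqrt (Real.sin (2 * θ) ^ q) ^ 2 = Real.sin (2 * θ) ^ q := fun θ hθ =>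
    Real.sq_sqrt (Real.rpow_nonneg (sin_two_mul_pos_of_mem hθ).le q)
  have e1 : ∫ θ in Ioo 0 (π / 2), u θ * v θ * w θ * Real.sin (2 * θ) ^ q = ∫ θ in Ioo 0 (π / 2), φ θ * ψ θ := by
    refine setIntegral_congr_fun measurableSet_Ioo fun θ hθ => ?_
    have e : φ θ * ψ θ = u θ * v θ * w θ * Real.sqrt (Real.sin (2 * θ) ^ q) ^ 2 := by simp only [hφ, hψ]; ring
    rw [e, hsq θ hθ]
  have e2 : wsq q u = ∫ θ in Ioo 0 (π / 2), φ θ ^ 2 := by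
    refine setIntegral_congr_fun measurableSet_Ioo fun θ hθ => ?_
    simp only [hφ]; rw [mul_pow, hsq θ hθ]
  have e3 : ∫ θ in Ioo 0 (π / 2), ψ θ ^ 2 ≤ wsq q v := by
    refine setIntegral_mono_on (integrableOn_Ioo_of_continuous (hψc.pow 2)) (integrableOn_sq_mul_sin_rpow hq hv)
      measurableSet_Ioo fun θ hθ => ?_
    simp only [hψ]; rw [mul_pow, mul_pow, hsq θ hθ]
    have hw2 : w θ ^ 2 ≤ 1 := by have := hw1 θ; rw [← sq_abs]; nlinarith [abs_nonneg (w θ)]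
    have hs0 : 0 ≤ Real.sin (2 * θ) ^ q := Real.rpow_nonneg (sin_two_mul_pos_of_mem hθ).le q
    nlinarith [mul_nonneg (sq_nonneg (v θ)) hs0, mul_le_mul_of_nonneg_left hw2 (mul_nonneg (sq_nonneg (v θ)) hs0)]
  have hcs := sq_integral_mul_le (μ := volume.restrict (Ioo (0:ℝ) (π / 2))) (φ := φ) (ψ := ψ)
    (integrableOn_Ioo_of_continuous (hφc.pow 2)) (integrableOn_Ioo_of_continuous (hψc.pow 2))
    (integrableOn_Ioo_of_continuous (hφc.mul hψc))
  rw [e1, ← Real.sqrt_mul (wsq_nonneg q u), e2]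
  refine Real.abs_le_sqrt (hcs.trans ?_)
  exact mul_le_mul_of_nonneg_left e3 (integral_nonneg fun _ => sq_nonneg _)

/-- **Lemma 8.23 of [Elgindi2021] in the angular variable** (two-ended, non-sharp constant): for
`k ≥ 1`, `1 < γ < 2`, `g ∈ C^∞(ℝ)` and `f = sin 2θ·g`,
`∫_{(0,π/2)} (g⁽ᵏ⁾)² S^{2k−γ} ≤ 2∫ (f⁽ᵏ⁺¹⁾)² S^{2k−γ} + 2·16ᵏ⁺¹k·Σ_{m<k} ∫ (g⁽ᵐ⁾)² S^{2k−γ}`, `S = sin 2θ`.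
Proof: the multiplier `S^{2k−γ}cos 2θ·g⁽ᵏ⁾` against `f⁽ᵏ⁺¹⁾ = Sg⁽ᵏ⁺¹⁾ + 2(k+1)cos 2θ g⁽ᵏ⁾ + R_k` gives,
after the integration by parts `integral_sin_rpow_cos_mul_mul_deriv`,
`(1+γ)∫S^{2k−γ}cos²(g⁽ᵏ⁾)² + ∫S^{2k+2−γ}(g⁽ᵏ⁾)² = ∫S^{2k−γ}cos·g⁽ᵏ⁾f⁽ᵏ⁺¹⁾ − ∫S^{2k−γ}cos·g⁽ᵏ⁾R_k`, whence
`T ≤ √T(√Y + √Z)` by Cauchy–Schwarz. [cite: Elgindi2021, §8.5 Lemma 8.23 (p. 29 of arXiv:1904.04795)] -/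
theorem wsq_iteratedDeriv_le {k : ℕ} (hk : 1 ≤ k) {γ : ℝ} (hγ1 : 1 < γ) (hγ2 : γ < 2) {g : ℝ → ℝ} (hg : ContDiff ℝ ∞ g) :
    wsq (2 * k - γ) (iteratedDeriv k g) ≤
      2 * wsq (2 * k - γ) (iteratedDeriv (k + 1) fun x => Real.sin (2 * x) * g x) +
        2 * (16 ^ (k + 1) * k) * ∑ m ∈ range k, wsq (2 * k - γ) (iteratedDeriv m g) := by
  -- notation
  set q : ℝ := 2 * k - γ with hq
  have hk1 : (1 : ℝ) ≤ k := by exact_mod_cast hk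
  have hq0 : 0 < q := by rw [hq]; linarith
  have hp1 : 1 ≤ q + 1 := by linarith
  set a := iteratedDeriv k g with ha
  set b := iteratedDeriv (k + 1) g with hb
  set f : ℝ → ℝ := fun x => Real.sin (2 * x) * g x with hf
  set F := iteratedDeriv (k + 1) f with hF
  set R := leibnizRem k g with hR
  -- regularity
  have hac : Continuous a := hg.continuous_iteratedDeriv k (natCast_le_infty _)
  have hbc : Continuous b := hg.continuous_iteratedDeriv (k + 1) (natCast_le_infty _)
  have hfs : ContDiff ℝ ∞ f := contDiff_sin_two_mul.mul hg
  have hFc : Continuous F := hfs.continuous_iteratedDeriv (k + 1) (natCast_le_infty _)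
  have hRc : Continuous R := continuous_leibnizRem k hg
  have hcS : Continuous fun θ : ℝ => Real.sin (2 * θ) := Real.continuous_sin.comp (continuous_const.mul continuous_id)
  have hcC : Continuous fun θ : ℝ => Real.cos (2 * θ) := Real.continuous_cos.comp (continuous_const.mul continuous_id)
  have hcq : Continuous fun θ : ℝ => Real.sin (2 * θ) ^ q := continuous_sin2_rpow hq0.le
  have hcp : Continuous fun θ : ℝ => Real.sin (2 * θ) ^ (q + 1) := continuous_sin2_rpow (by linarith)
  have hda : ∀ θ, HasDerivAt a (b θ) θ := fun θ => by
    have hd : Differentiable ℝ a := hg.differentiable_iteratedDeriv k (natCast_lt_infty _)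
    have h := (hd θ).hasDerivAt
    have e : deriv a θ = b θ := by rw [hb, iteratedDeriv_succ]
    rwa [e] at h
  -- (1) Leibniz
  have hLeib : ∀ θ, F θ = Real.sin (2 * θ) * b θ + 2 * (k + 1) * Real.cos (2 * θ) * a θ + R θ :=
    iteratedDeriv_sin_mul k hk hg
  -- (2) the pieces
  set T := wsq q a with hT
  set X := wsq q (fun θ => Real.cos (2 * θ) * a θ) with hX
  set P := wsq q (fun θ => Real.sin (2 * θ) * a θ) with hP
  set Y := wsq q F with hY
  set Z := wsq q R with hZ
  set I₁ := ∫ θ in Ioo 0 (π / 2), a θ * F θ * Real.cos (2 * θ) * Real.sin (2 * θ) ^ q with hI₁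
  set I₂ := ∫ θ in Ioo 0 (π / 2), a θ * R θ * Real.cos (2 * θ) * Real.sin (2 * θ) ^ q with hI₂
  set J := ∫ θ in Ioo 0 (π / 2), Real.sin (2 * θ) ^ (q + 1) * Real.cos (2 * θ) * a θ * b θ with hJ
  have hTn : 0 ≤ T := wsq_nonneg _ _
  have hXn : 0 ≤ X := wsq_nonneg _ _
  have hYn : 0 ≤ Y := wsq_nonneg _ _
  have hZn : 0 ≤ Z := wsq_nonneg _ _
  -- integrability of everything in sight
  have iX : IntegrableOn (fun θ => (Real.cos (2 * θ) * a θ) ^ 2 * Real.sin (2 * θ) ^ q) (Ioo 0 (π / 2)) :=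
    integrableOn_sq_mul_sin_rpow hq0.le (hcC.mul hac)
  have iP : IntegrableOn (fun θ => (Real.sin (2 * θ) * a θ) ^ 2 * Real.sin (2 * θ) ^ q) (Ioo 0 (π / 2)) :=
    integrableOn_sq_mul_sin_rpow hq0.le (hcS.mul hac)
  have iJ : IntegrableOn (fun θ => Real.sin (2 * θ) ^ (q + 1) * Real.cos (2 * θ) * a θ * b θ) (Ioo 0 (π / 2)) :=
    integrableOn_Ioo_of_continuous (((hcp.mul hcC).mul hac).mul hbc)
  have iR : IntegrableOn (fun θ => a θ * R θ * Real.cos (2 * θ) * Real.sin (2 * θ) ^ q) (Ioo 0 (π / 2)) :=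
    integrableOn_Ioo_of_continuous (((hac.mul hRc).mul hcC).mul hcq)
  -- (3) `T = X + P`
  have hTXP : T = X + P := by
    rw [hT, hX, hP]; unfold wsq
    rw [← integral_add iX iP]
    refine setIntegral_congr_fun measurableSet_Ioo fun θ _ => ?_
    have h1 := Real.cos_sq_add_sin_sq (2 * θ)
    calc a θ ^ 2 * Real.sin (2 * θ) ^ q = (Real.cos (2 * θ) ^ 2 + Real.sin (2 * θ) ^ 2) * a θ ^ 2 * Real.sin (2 * θ) ^ q := by
          rw [h1, one_mul]
      _ = _ := by ring
  -- (4) the integration by parts: `J = −(q+1)X + P`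
  have hibp := integral_sin_rpow_cos_mul_mul_deriv hp1 hac hbc hda
  have hJXP : J = -(q + 1) * X + P := by
    rw [hJ, hibp, add_sub_cancel_right]
    congr 1
    · congr 1
      rw [hX]; unfold wsq
      exact setIntegral_congr_fun measurableSet_Ioo fun θ _ => by ring
    · rw [hP]; unfold wsq
      refine setIntegral_congr_fun measurableSet_Ioo fun θ hθ => ?_
      rw [Real.rpow_add_one (sin_two_mul_pos_of_mem hθ).ne' q]; ring
  -- (5) the multiplier identity: `I₁ = J + 2(k+1)X + I₂`
  have hI₁J : I₁ = J + 2 * (k + 1) * X + I₂ := by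
    have e : I₁ = ∫ θ in Ioo 0 (π / 2), ((Real.sin (2 * θ) ^ (q + 1) * Real.cos (2 * θ) * a θ * b θ +
        2 * (k + 1) * ((Real.cos (2 * θ) * a θ) ^ 2 * Real.sin (2 * θ) ^ q)) + a θ * R θ * Real.cos (2 * θ) * Real.sin (2 * θ) ^ q) := by
      rw [hI₁]; refine setIntegral_congr_fun measurableSet_Ioo fun θ hθ => ?_
      rw [hLeib θ, Real.rpow_add_one (sin_two_mul_pos_of_mem hθ).ne' q]; ring
    have iX2 : IntegrableOn (fun θ => 2 * (k + 1) * ((Real.cos (2 * θ) * a θ) ^ 2 * Real.sin (2 * θ) ^ q)) (Ioo 0 (π / 2)) :=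
      iX.const_mul _
    have iJX : IntegrableOn (fun θ => Real.sin (2 * θ) ^ (q + 1) * Real.cos (2 * θ) * a θ * b θ +
        2 * (k + 1) * ((Real.cos (2 * θ) * a θ) ^ 2 * Real.sin (2 * θ) ^ q)) (Ioo 0 (π / 2)) := iJ.add iX2
    rw [e, integral_add iJX iR, integral_add iJ iX2, MeasureTheory.integral_const_mul, hJ, hX, hI₂]
    rfl
  -- (6) hence `(1+γ)X + P = I₁ − I₂` and `T ≤ |I₁| + |I₂|`
  have hkey : (1 + γ) * X + P = I₁ - I₂ := by
    rw [hI₁J, hJXP, hq]; ring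
  have hT1 : T ≤ |I₁| + |I₂| := by
    have h1 : T ≤ (1 + γ) * X + P := by rw [hTXP]; nlinarith
    rw [hkey] at h1
    linarith [le_abs_self I₁, neg_abs_le I₂]
  -- (7) Cauchy–Schwarz
  have hC1 : ∀ θ, |Real.cos (2 * θ)| ≤ 1 := fun θ => Real.abs_cos_le_one _
  have hI₁le : |I₁| ≤ Real.sqrt T * Real.sqrt Y := abs_integral_mul_mul_sin_rpow_le hq0.le hac hFc hcC hC1
  have hI₂le : |I₂| ≤ Real.sqrt T * Real.sqrt Z := abs_integral_mul_mul_sin_rpow_le hq0.le hac hRc hcC hC1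
  -- (8) `T ≤ 2Y + 2Z`
  have hT2 : T ≤ 2 * Y + 2 * Z := by
    have hs : T ≤ Real.sqrt T * (Real.sqrt Y + Real.sqrt Z) := by nlinarith
    have hYs := Real.sqrt_nonneg Y
    have hZs := Real.sqrt_nonneg Z
    have hTs := Real.sqrt_nonneg T
    rcases hTn.lt_or_eq with hpos | hzero
    · have hsT : 0 < Real.sqrt T := Real.sqrt_pos.2 hpos
      have h2 : Real.sqrt T ≤ Real.sqrt Y + Real.sqrt Z := by
        have h3 : Real.sqrt T * Real.sqrt T ≤ Real.sqrt T * (Real.sqrt Y + Real.sqrt Z) := by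
          rwa [Real.mul_self_sqrt hTn]
        exact le_of_mul_le_mul_left h3 hsT
      nlinarith [Real.sq_sqrt hYn, Real.sq_sqrt hZn, Real.sq_sqrt hTn, sq_nonneg (Real.sqrt Y - Real.sqrt Z),
        mul_le_mul h2 h2 hTs (by linarith)]
    · rw [← hzero]; nlinarith
  -- (9) the remainder integral
  have hZle : Z ≤ 16 ^ (k + 1) * k * ∑ m ∈ range k, wsq q (iteratedDeriv m g) := by
    have im : ∀ m ∈ range k, IntegrableOn (fun θ => iteratedDeriv m g θ ^ 2 * Real.sin (2 * θ) ^ q) (Ioo 0 (π / 2)) :=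
      fun m _ => integrableOn_sq_mul_sin_rpow hq0.le (hg.continuous_iteratedDeriv m (natCast_le_infty _))
    have e : ∑ m ∈ range k, wsq q (iteratedDeriv m g) = ∫ θ in Ioo 0 (π / 2), ∑ m ∈ range k, iteratedDeriv m g θ ^ 2 * Real.sin (2 * θ) ^ q := by
      unfold wsq; rw [integral_finsetSum _ im]
    rw [e, ← MeasureTheory.integral_const_mul, hZ]
    unfold wsq
    have hint : IntegrableOn (fun θ => 16 ^ (k + 1) * k * ∑ m ∈ range k, iteratedDeriv m g θ ^ 2 * Real.sin (2 * θ) ^ q) (Ioo 0 (π / 2)) :=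
      (integrable_finsetSum _ im).const_mul _
    refine setIntegral_mono_on (integrableOn_sq_mul_sin_rpow hq0.le hRc) hint measurableSet_Ioo fun θ hθ => ?_
    have hs0 : 0 ≤ Real.sin (2 * θ) ^ q := Real.rpow_nonneg (sin_two_mul_pos_of_mem hθ).le q
    have h := mul_le_mul_of_nonneg_right (sq_leibnizRem_le k g θ) hs0
    rw [mul_assoc, Finset.sum_mul] at h
    exact h
  -- (10) conclusion
  calc T ≤ 2 * Y + 2 * Z := hT2
    _ ≤ 2 * Y + 2 * (16 ^ (k + 1) * k * ∑ m ∈ range k, wsq q (iteratedDeriv m g)) := by linarith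
    _ = _ := by ring


/-! ### From powers `Sᵐ∂ᵐ` to words `D_θⁱ` and back -/

/-- On `(0, π/2)`: `S^n·x·S^{−γ} = x·S^{n−γ}` (`S = sin 2θ`). [folklore] -/
theorem sin_pow_mul_mul_rpow_neg {θ : ℝ} (hθ : θ ∈ Ioo 0 (π / 2)) (n : ℕ) (x γ : ℝ) :
    Real.sin (2 * θ) ^ n * x * Real.sin (2 * θ) ^ (-γ) = x * Real.sin (2 * θ) ^ ((n : ℝ) - γ) := by
  have hs := sin_two_mul_pos_of_mem hθ
  rw [sub_eq_add_neg, Real.rpow_add hs, Real.rpow_natCast]; ring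

/-- **Domination on `(0, π/2)`**: a measurable `L` with `0 ≤ L ≤ R` pointwise and `R` integrable is
integrable with `∫L ≤ ∫R`. [folklore] -/
theorem setIntegral_Ioo_le_of_le {L R : ℝ → ℝ} (hL : Measurable L) (hR : IntegrableOn R (Ioo 0 (π / 2)))
    (h0 : ∀ θ ∈ Ioo 0 (π / 2), 0 ≤ L θ) (h : ∀ θ ∈ Ioo 0 (π / 2), L θ ≤ R θ) :
    IntegrableOn L (Ioo 0 (π / 2)) ∧ ∫ θ in Ioo 0 (π / 2), L θ ≤ ∫ θ in Ioo 0 (π / 2), R θ := by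
  have hi : IntegrableOn L (Ioo 0 (π / 2)) := by
    refine Integrable.mono' hR hL.aestronglyMeasurable ?_
    rw [ae_restrict_iff' measurableSet_Ioo]
    exact Filter.Eventually.of_forall fun θ hθ => by rw [Real.norm_eq_abs, abs_of_nonneg (h0 θ hθ)]; exact h θ hθ
  exact ⟨hi, setIntegral_mono_on hi hR measurableSet_Ioo h⟩

/-- Measurability of `sin(2θ)^q`. [folklore] -/
theorem measurable_sin_two_mul_rpow (q : ℝ) : Measurable fun θ : ℝ => Real.sin (2 * θ) ^ q :=
  (Real.continuous_sin.measurable.comp (measurable_const.mul measurable_id)).pow_const q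

/-- The words `Dθ₁^[i] g` of a smooth function are continuous. [folklore] -/
theorem continuous_iterate_Dθ₁ {g : ℝ → ℝ} (hg : ContDiff ℝ ∞ g) (i : ℕ) : Continuous (Dθ₁^[i] g) := by
  have key : ∀ i, ∀ {g : ℝ → ℝ}, ContDiff ℝ ∞ g → ContDiff ℝ ∞ (Dθ₁^[i] g) := by
    intro i
    induction i with
    | zero => intro g hg; exact hg
    | succ i ih =>
      intro g hg
      rw [Function.iterate_succ_apply]
      refine ih ?_
      have e : Dθ₁ g = fun θ => Real.sin (2 * θ) * deriv g θ := rfl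
      rw [e]
      exact contDiff_sin_two_mul.mul (hg.deriv')
  exact (key i hg).continuous

/-- **Up**: `Σ_{i=1}^4 ∫(D_θⁱg)²S^{−γ} ≤ 6457·Σ_{m=1}^4 ∫(g⁽ᵐ⁾)²S^{2m−γ}`, and the word integrands are
integrable (`1 < γ < 2`). [cite: ElgindiGhoulMasmoudi2021, §1.7 (p. 6 of arXiv:1910.14071): the angular weights of 𝓗ᵏ] -/
theorem wsq_iterate_Dθ₁_le {γ : ℝ} (hγ2 : γ < 2) {g : ℝ → ℝ} (hg : ContDiff ℝ ∞ g) :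
    (∀ i, 1 ≤ i → i ≤ 4 → IntegrableOn (fun θ => (Dθ₁^[i] g) θ ^ 2 * Real.sin (2 * θ) ^ (-γ)) (Ioo 0 (π / 2))) ∧
    wsq (-γ) (Dθ₁^[1] g) ≤ 6457 * wsq (2 - γ) (iteratedDeriv 1 g) ∧
    wsq (-γ) (Dθ₁^[1] g) + wsq (-γ) (Dθ₁^[2] g) ≤ 6457 * (wsq (2 - γ) (iteratedDeriv 1 g) + wsq (4 - γ) (iteratedDeriv 2 g)) ∧
    wsq (-γ) (Dθ₁^[1] g) + wsq (-γ) (Dθ₁^[2] g) + wsq (-γ) (Dθ₁^[3] g) ≤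
      6457 * (wsq (2 - γ) (iteratedDeriv 1 g) + wsq (4 - γ) (iteratedDeriv 2 g) + wsq (6 - γ) (iteratedDeriv 3 g)) ∧
    wsq (-γ) (Dθ₁^[1] g) + wsq (-γ) (Dθ₁^[2] g) + wsq (-γ) (Dθ₁^[3] g) + wsq (-γ) (Dθ₁^[4] g) ≤
      6457 * (wsq (2 - γ) (iteratedDeriv 1 g) + wsq (4 - γ) (iteratedDeriv 2 g) + wsq (6 - γ) (iteratedDeriv 3 g) +
        wsq (8 - γ) (iteratedDeriv 4 g)) := by
  have hg4 : ContDiff ℝ 4 g := hg.of_le (natCast_le_infty 4)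
  -- the power integrands
  set P : ℕ → ℝ → ℝ := fun m θ => iteratedDeriv m g θ ^ 2 * Real.sin (2 * θ) ^ ((((2 * m : ℕ)) : ℝ) - γ) with hPdef
  have hPc : ∀ m, 1 ≤ m → Continuous (P m) := fun m hm =>
    ((hg.continuous_iteratedDeriv m (natCast_le_infty _)).pow 2).mul
      (continuous_sin2_rpow (by have h1 : (1:ℝ) ≤ (m:ℝ) := Nat.one_le_cast.mpr hm; push_cast; linarith))
  have hPi : ∀ m, 1 ≤ m → IntegrableOn (P m) (Ioo 0 (π / 2)) := fun m hm => integrableOn_Ioo_of_continuous (hPc m hm)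
  have hPn : ∀ m θ, θ ∈ Ioo (0:ℝ) (π / 2) → 0 ≤ P m θ := fun m θ hθ =>
    mul_nonneg (sq_nonneg _) (Real.rpow_nonneg (sin_two_mul_pos_of_mem hθ).le _)
  have hPw : ∀ m : ℕ, 1 ≤ m → wsq (2 * (m : ℝ) - γ) (iteratedDeriv m g) = ∫ θ in Ioo 0 (π / 2), P m θ := fun m _ => by
    simp only [hPdef, wsq]; push_cast; rfl
  -- pointwise conversions `S^{2m}(g⁽ᵐ⁾)²S^{−γ} = P m`
  have hconv : ∀ m θ, θ ∈ Ioo (0:ℝ) (π / 2) →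
      Real.sin (2 * θ) ^ (2 * m) * iteratedDeriv m g θ ^ 2 * Real.sin (2 * θ) ^ (-γ) = P m θ := fun m θ hθ => by
    simp only [hPdef]; exact sin_pow_mul_mul_rpow_neg hθ (2 * m) _ γ
  have hmeas : ∀ i, Measurable fun θ => (Dθ₁^[i] g) θ ^ 2 * Real.sin (2 * θ) ^ (-γ) := fun i =>
    ((continuous_iterate_Dθ₁ hg i).measurable.pow_const 2).mul (measurable_sin_two_mul_rpow _)
  have hnn : ∀ i θ, θ ∈ Ioo (0:ℝ) (π / 2) → 0 ≤ (Dθ₁^[i] g) θ ^ 2 * Real.sin (2 * θ) ^ (-γ) := fun i θ hθ =>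
    mul_nonneg (sq_nonneg _) (Real.rpow_nonneg (sin_two_mul_pos_of_mem hθ).le _)
  -- i = 1
  have h1 := setIntegral_Ioo_le_of_le (hmeas 1) (hPi 1 le_rfl) (hnn 1) fun θ hθ => by
    rw [sq_iterate_Dθ₁_one, ← hconv 1 θ hθ]
  -- i = 2
  have hR2 : IntegrableOn (fun θ => 8 * P 1 θ + 2 * P 2 θ) (Ioo 0 (π / 2)) :=
    ((hPi 1 le_rfl).const_mul 8).add ((hPi 2 (by norm_num)).const_mul 2)
  have h2 := setIntegral_Ioo_le_of_le (hmeas 2) hR2 (hnn 2) fun θ hθ => by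
    have h := mul_le_mul_of_nonneg_right (sq_iterate_Dθ₁_two_le hg4 θ) (Real.rpow_nonneg (sin_two_mul_pos_of_mem hθ).le (-γ))
    rw [← hconv 1 θ hθ, ← hconv 2 θ hθ]; ring_nf at h ⊢; linarith
  -- i = 3
  have hR3 : IntegrableOn (fun θ => 48 * P 1 θ + 108 * P 2 θ + 3 * P 3 θ) (Ioo 0 (π / 2)) :=
    (((hPi 1 le_rfl).const_mul 48).add ((hPi 2 (by norm_num)).const_mul 108)).add ((hPi 3 (by norm_num)).const_mul 3)
  have h3 := setIntegral_Ioo_le_of_le (hmeas 3) hR3 (hnn 3) fun θ hθ => by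
    have h := mul_le_mul_of_nonneg_right (sq_iterate_Dθ₁_three_le hg4 θ) (Real.rpow_nonneg (sin_two_mul_pos_of_mem hθ).le (-γ))
    rw [← hconv 1 θ hθ, ← hconv 2 θ hθ, ← hconv 3 θ hθ]; ring_nf at h ⊢; linarith
  -- i = 4
  have hR4 : IntegrableOn (fun θ => 6400 * P 1 θ + 3136 * P 2 θ + 576 * P 3 θ + 4 * P 4 θ) (Ioo 0 (π / 2)) :=
    ((((hPi 1 le_rfl).const_mul 6400).add ((hPi 2 (by norm_num)).const_mul 3136)).add ((hPi 3 (by norm_num)).const_mul 576)).add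
      ((hPi 4 (by norm_num)).const_mul 4)
  have h4 := setIntegral_Ioo_le_of_le (hmeas 4) hR4 (hnn 4) fun θ hθ => by
    have h := mul_le_mul_of_nonneg_right (sq_iterate_Dθ₁_four_le hg4 θ) (Real.rpow_nonneg (sin_two_mul_pos_of_mem hθ).le (-γ))
    rw [← hconv 1 θ hθ, ← hconv 2 θ hθ, ← hconv 3 θ hθ, ← hconv 4 θ hθ]; ring_nf at h ⊢; linarith
  refine ⟨fun i hi1 hi4 => ?_, ?_⟩
  · interval_cases i
    exacts [h1.1, h2.1, h3.1, h4.1]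
  -- evaluate the right-hand integrals
  have i1 := hPi 1 le_rfl; have i2 := hPi 2 (by norm_num); have i3 := hPi 3 (by norm_num); have i4 := hPi 4 (by norm_num)
  have e2 : ∫ θ in Ioo 0 (π / 2), 8 * P 1 θ + 2 * P 2 θ = 8 * (∫ θ in Ioo 0 (π / 2), P 1 θ) + 2 * ∫ θ in Ioo 0 (π / 2), P 2 θ := by
    rw [integral_add (i1.const_mul 8) (i2.const_mul 2), MeasureTheory.integral_const_mul, MeasureTheory.integral_const_mul]
  have e3 : ∫ θ in Ioo 0 (π / 2), 48 * P 1 θ + 108 * P 2 θ + 3 * P 3 θ =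
      48 * (∫ θ in Ioo 0 (π / 2), P 1 θ) + 108 * (∫ θ in Ioo 0 (π / 2), P 2 θ) + 3 * ∫ θ in Ioo 0 (π / 2), P 3 θ := by
    have i12 : IntegrableOn (fun θ => 48 * P 1 θ + 108 * P 2 θ) (Ioo 0 (π / 2)) := (i1.const_mul 48).add (i2.const_mul 108)
    rw [integral_add i12 (i3.const_mul 3), integral_add (i1.const_mul 48) (i2.const_mul 108), MeasureTheory.integral_const_mul,
      MeasureTheory.integral_const_mul, MeasureTheory.integral_const_mul]
  have e4 : ∫ θ in Ioo 0 (π / 2), 6400 * P 1 θ + 3136 * P 2 θ + 576 * P 3 θ + 4 * P 4 θ =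
      6400 * (∫ θ in Ioo 0 (π / 2), P 1 θ) + 3136 * (∫ θ in Ioo 0 (π / 2), P 2 θ) + 576 * (∫ θ in Ioo 0 (π / 2), P 3 θ) +
        4 * ∫ θ in Ioo 0 (π / 2), P 4 θ := by
    have i12 : IntegrableOn (fun θ => 6400 * P 1 θ + 3136 * P 2 θ) (Ioo 0 (π / 2)) := (i1.const_mul 6400).add (i2.const_mul 3136)
    have i123 : IntegrableOn (fun θ => 6400 * P 1 θ + 3136 * P 2 θ + 576 * P 3 θ) (Ioo 0 (π / 2)) := i12.add (i3.const_mul 576)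
    rw [integral_add i123 (i4.const_mul 4), integral_add i12 (i3.const_mul 576), integral_add (i1.const_mul 6400) (i2.const_mul 3136),
      MeasureTheory.integral_const_mul, MeasureTheory.integral_const_mul, MeasureTheory.integral_const_mul, MeasureTheory.integral_const_mul]
  have w1 : wsq (2 - γ) (iteratedDeriv 1 g) = ∫ θ in Ioo 0 (π / 2), P 1 θ := by rw [← hPw 1 le_rfl]; norm_num
  have w2 : wsq (4 - γ) (iteratedDeriv 2 g) = ∫ θ in Ioo 0 (π / 2), P 2 θ := by rw [← hPw 2 (by norm_num)]; norm_num
  have w3 : wsq (6 - γ) (iteratedDeriv 3 g) = ∫ θ in Ioo 0 (π / 2), P 3 θ := by rw [← hPw 3 (by norm_num)]; norm_num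
  have w4 : wsq (8 - γ) (iteratedDeriv 4 g) = ∫ θ in Ioo 0 (π / 2), P 4 θ := by rw [← hPw 4 (by norm_num)]; norm_num
  have n1 : 0 ≤ ∫ θ in Ioo 0 (π / 2), P 1 θ := setIntegral_nonneg measurableSet_Ioo (hPn 1)
  have n2 : 0 ≤ ∫ θ in Ioo 0 (π / 2), P 2 θ := setIntegral_nonneg measurableSet_Ioo (hPn 2)
  have n3 : 0 ≤ ∫ θ in Ioo 0 (π / 2), P 3 θ := setIntegral_nonneg measurableSet_Ioo (hPn 3)
  have n4 : 0 ≤ ∫ θ in Ioo 0 (π / 2), P 4 θ := setIntegral_nonneg measurableSet_Ioo (hPn 4)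
  have b1 := h1.2; have b2 := h2.2; have b3 := h3.2; have b4 := h4.2
  rw [e2] at b2; rw [e3] at b3; rw [e4] at b4
  rw [w1, w2, w3, w4]
  unfold wsq
  exact ⟨by linarith, by linarith, by linarith, by linarith⟩


/-- **Down**: `Σ_{m=1}^4 ∫(h⁽ᵐ⁾)²S^{2m−γ} ≤ 6·10⁵·Σ_{l=1}^4 ∫(D_θˡh)²S^{−γ}` for `h ∈ C^∞(ℝ)`, `γ < 2`. [cite: ElgindiGhoulMasmoudi2021, §1.7 (p. 6 of arXiv:1910.14071): the angular weights of 𝓗ᵏ] -/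
theorem wsq_iteratedDeriv_le_wsq_iterate_Dθ₁ {γ : ℝ} (hγ2 : γ < 2) {h : ℝ → ℝ} (hh : ContDiff ℝ ∞ h) :
    wsq (2 - γ) (iteratedDeriv 1 h) ≤ 600000 * wsq (-γ) (Dθ₁^[1] h) ∧
    wsq (2 - γ) (iteratedDeriv 1 h) + wsq (4 - γ) (iteratedDeriv 2 h) ≤ 600000 * (wsq (-γ) (Dθ₁^[1] h) + wsq (-γ) (Dθ₁^[2] h)) ∧
    wsq (2 - γ) (iteratedDeriv 1 h) + wsq (4 - γ) (iteratedDeriv 2 h) + wsq (6 - γ) (iteratedDeriv 3 h) ≤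
      600000 * (wsq (-γ) (Dθ₁^[1] h) + wsq (-γ) (Dθ₁^[2] h) + wsq (-γ) (Dθ₁^[3] h)) ∧
    wsq (2 - γ) (iteratedDeriv 1 h) + wsq (4 - γ) (iteratedDeriv 2 h) + wsq (6 - γ) (iteratedDeriv 3 h) + wsq (8 - γ) (iteratedDeriv 4 h) ≤
      600000 * (wsq (-γ) (Dθ₁^[1] h) + wsq (-γ) (Dθ₁^[2] h) + wsq (-γ) (Dθ₁^[3] h) + wsq (-γ) (Dθ₁^[4] h)) := by
  have hh4 : ContDiff ℝ 4 h := hh.of_le (natCast_le_infty 4)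
  obtain ⟨hint, -⟩ := wsq_iterate_Dθ₁_le hγ2 hh
  set B : ℕ → ℝ → ℝ := fun l θ => (Dθ₁^[l] h) θ ^ 2 * Real.sin (2 * θ) ^ (-γ) with hBdef
  have iB : ∀ l, 1 ≤ l → l ≤ 4 → IntegrableOn (B l) (Ioo 0 (π / 2)) := fun l h1 h4 => hint l h1 h4
  have hBn : ∀ l θ, θ ∈ Ioo (0:ℝ) (π / 2) → 0 ≤ B l θ := fun l θ hθ =>
    mul_nonneg (sq_nonneg _) (Real.rpow_nonneg (sin_two_mul_pos_of_mem hθ).le _)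
  have hBw : ∀ l, wsq (-γ) (Dθ₁^[l] h) = ∫ θ in Ioo 0 (π / 2), B l θ := fun l => rfl
  -- the power integrands and their measurability
  have hconv : ∀ (m : ℕ) θ, θ ∈ Ioo (0:ℝ) (π / 2) →
      iteratedDeriv m h θ ^ 2 * Real.sin (2 * θ) ^ ((((2 * m : ℕ)) : ℝ) - γ) =
        Real.sin (2 * θ) ^ (2 * m) * iteratedDeriv m h θ ^ 2 * Real.sin (2 * θ) ^ (-γ) := fun m θ hθ =>
    (sin_pow_mul_mul_rpow_neg hθ (2 * m) _ γ).symm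
  have hmeas : ∀ m : ℕ, Measurable fun θ => iteratedDeriv m h θ ^ 2 * Real.sin (2 * θ) ^ ((((2 * m : ℕ)) : ℝ) - γ) := fun m =>
    ((hh.continuous_iteratedDeriv m (natCast_le_infty _)).measurable.pow_const 2).mul (measurable_sin_two_mul_rpow _)
  have hnn : ∀ (m : ℕ) θ, θ ∈ Ioo (0:ℝ) (π / 2) → 0 ≤ iteratedDeriv m h θ ^ 2 * Real.sin (2 * θ) ^ ((((2 * m : ℕ)) : ℝ) - γ) :=
    fun m θ hθ => mul_nonneg (sq_nonneg _) (Real.rpow_nonneg (sin_two_mul_pos_of_mem hθ).le _)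
  have i1 := iB 1 le_rfl (by norm_num); have i2 := iB 2 (by norm_num) (by norm_num)
  have i3 := iB 3 (by norm_num) (by norm_num); have i4 := iB 4 (by norm_num) le_rfl
  -- pointwise down inequalities, combined
  have pw : ∀ θ, Real.sin (2 * θ) ^ 2 * iteratedDeriv 1 h θ ^ 2 = (Dθ₁^[1] h) θ ^ 2 ∧
      Real.sin (2 * θ) ^ 4 * iteratedDeriv 2 h θ ^ 2 ≤ 8 * (Dθ₁^[1] h) θ ^ 2 + 2 * (Dθ₁^[2] h) θ ^ 2 ∧
      Real.sin (2 * θ) ^ 6 * iteratedDeriv 3 h θ ^ 2 ≤ 912 * (Dθ₁^[1] h) θ ^ 2 + 216 * (Dθ₁^[2] h) θ ^ 2 + 3 * (Dθ₁^[3] h) θ ^ 2 ∧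
      Real.sin (2 * θ) ^ 8 * iteratedDeriv 4 h θ ^ 2 ≤ 556800 * (Dθ₁^[1] h) θ ^ 2 + 130688 * (Dθ₁^[2] h) θ ^ 2 +
        1728 * (Dθ₁^[3] h) θ ^ 2 + 4 * (Dθ₁^[4] h) θ ^ 2 := fun θ => by
    have e1 := sq_iterate_Dθ₁_one h θ
    have d2 := sq_sin_pow_mul_iteratedDeriv_two_le hh4 θ
    have d3 := sq_sin_pow_mul_iteratedDeriv_three_le hh4 θ
    have d4 := sq_sin_pow_mul_iteratedDeriv_four_le hh4 θ
    exact ⟨e1.symm, by linarith, by linarith, by linarith⟩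
  -- m = 1
  have h1 := setIntegral_Ioo_le_of_le (hmeas 1) i1 (hnn 1) fun θ hθ => by
    rw [hconv 1 θ hθ, show (2 * 1 : ℕ) = 2 from rfl, (pw θ).1]
  have hR2 : IntegrableOn (fun θ => 8 * B 1 θ + 2 * B 2 θ) (Ioo 0 (π / 2)) := (i1.const_mul 8).add (i2.const_mul 2)
  have h2 := setIntegral_Ioo_le_of_le (hmeas 2) hR2 (hnn 2) fun θ hθ => by
    rw [hconv 2 θ hθ, show (2 * 2 : ℕ) = 4 from rfl]
    have hle := mul_le_mul_of_nonneg_right (pw θ).2.1 (Real.rpow_nonneg (sin_two_mul_pos_of_mem hθ).le (-γ))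
    simp only [hBdef]; linarith [hle, show (8 * (Dθ₁^[1] h) θ ^ 2 + 2 * (Dθ₁^[2] h) θ ^ 2) * Real.sin (2 * θ) ^ (-γ) =
      8 * ((Dθ₁^[1] h) θ ^ 2 * Real.sin (2 * θ) ^ (-γ)) + 2 * ((Dθ₁^[2] h) θ ^ 2 * Real.sin (2 * θ) ^ (-γ)) by ring]
  have hR3 : IntegrableOn (fun θ => 912 * B 1 θ + 216 * B 2 θ + 3 * B 3 θ) (Ioo 0 (π / 2)) :=
    ((i1.const_mul 912).add (i2.const_mul 216)).add (i3.const_mul 3)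
  have h3 := setIntegral_Ioo_le_of_le (hmeas 3) hR3 (hnn 3) fun θ hθ => by
    rw [hconv 3 θ hθ, show (2 * 3 : ℕ) = 6 from rfl]
    have hle := mul_le_mul_of_nonneg_right (pw θ).2.2.1 (Real.rpow_nonneg (sin_two_mul_pos_of_mem hθ).le (-γ))
    simp only [hBdef]
    linarith [hle, show (912 * (Dθ₁^[1] h) θ ^ 2 + 216 * (Dθ₁^[2] h) θ ^ 2 + 3 * (Dθ₁^[3] h) θ ^ 2) * Real.sin (2 * θ) ^ (-γ) =
      912 * ((Dθ₁^[1] h) θ ^ 2 * Real.sin (2 * θ) ^ (-γ)) + 216 * ((Dθ₁^[2] h) θ ^ 2 * Real.sin (2 * θ) ^ (-γ)) +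
      3 * ((Dθ₁^[3] h) θ ^ 2 * Real.sin (2 * θ) ^ (-γ)) by ring]
  have hR4 : IntegrableOn (fun θ => 556800 * B 1 θ + 130688 * B 2 θ + 1728 * B 3 θ + 4 * B 4 θ) (Ioo 0 (π / 2)) :=
    (((i1.const_mul 556800).add (i2.const_mul 130688)).add (i3.const_mul 1728)).add (i4.const_mul 4)
  have h4 := setIntegral_Ioo_le_of_le (hmeas 4) hR4 (hnn 4) fun θ hθ => by
    rw [hconv 4 θ hθ, show (2 * 4 : ℕ) = 8 from rfl]
    have hle := mul_le_mul_of_nonneg_right (pw θ).2.2.2 (Real.rpow_nonneg (sin_two_mul_pos_of_mem hθ).le (-γ))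
    simp only [hBdef]
    linarith [hle, show (556800 * (Dθ₁^[1] h) θ ^ 2 + 130688 * (Dθ₁^[2] h) θ ^ 2 + 1728 * (Dθ₁^[3] h) θ ^ 2 + 4 * (Dθ₁^[4] h) θ ^ 2) *
      Real.sin (2 * θ) ^ (-γ) =
      556800 * ((Dθ₁^[1] h) θ ^ 2 * Real.sin (2 * θ) ^ (-γ)) + 130688 * ((Dθ₁^[2] h) θ ^ 2 * Real.sin (2 * θ) ^ (-γ)) +
      1728 * ((Dθ₁^[3] h) θ ^ 2 * Real.sin (2 * θ) ^ (-γ)) + 4 * ((Dθ₁^[4] h) θ ^ 2 * Real.sin (2 * θ) ^ (-γ)) by ring]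
  -- evaluate the right-hand integrals
  have e2 : ∫ θ in Ioo 0 (π / 2), 8 * B 1 θ + 2 * B 2 θ = 8 * (∫ θ in Ioo 0 (π / 2), B 1 θ) + 2 * ∫ θ in Ioo 0 (π / 2), B 2 θ := by
    rw [integral_add (i1.const_mul 8) (i2.const_mul 2), MeasureTheory.integral_const_mul, MeasureTheory.integral_const_mul]
  have e3 : ∫ θ in Ioo 0 (π / 2), 912 * B 1 θ + 216 * B 2 θ + 3 * B 3 θ =
      912 * (∫ θ in Ioo 0 (π / 2), B 1 θ) + 216 * (∫ θ in Ioo 0 (π / 2), B 2 θ) + 3 * ∫ θ in Ioo 0 (π / 2), B 3 θ := by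
    have i12 : IntegrableOn (fun θ => 912 * B 1 θ + 216 * B 2 θ) (Ioo 0 (π / 2)) := (i1.const_mul 912).add (i2.const_mul 216)
    rw [integral_add i12 (i3.const_mul 3), integral_add (i1.const_mul 912) (i2.const_mul 216), MeasureTheory.integral_const_mul,
      MeasureTheory.integral_const_mul, MeasureTheory.integral_const_mul]
  have e4 : ∫ θ in Ioo 0 (π / 2), 556800 * B 1 θ + 130688 * B 2 θ + 1728 * B 3 θ + 4 * B 4 θ =
      556800 * (∫ θ in Ioo 0 (π / 2), B 1 θ) + 130688 * (∫ θ in Ioo 0 (π / 2), B 2 θ) + 1728 * (∫ θ in Ioo 0 (π / 2), B 3 θ) +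
        4 * ∫ θ in Ioo 0 (π / 2), B 4 θ := by
    have i12 : IntegrableOn (fun θ => 556800 * B 1 θ + 130688 * B 2 θ) (Ioo 0 (π / 2)) := (i1.const_mul 556800).add (i2.const_mul 130688)
    have i123 : IntegrableOn (fun θ => 556800 * B 1 θ + 130688 * B 2 θ + 1728 * B 3 θ) (Ioo 0 (π / 2)) := i12.add (i3.const_mul 1728)
    rw [integral_add i123 (i4.const_mul 4), integral_add i12 (i3.const_mul 1728), integral_add (i1.const_mul 556800) (i2.const_mul 130688),
      MeasureTheory.integral_const_mul, MeasureTheory.integral_const_mul, MeasureTheory.integral_const_mul, MeasureTheory.integral_const_mul]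
  have w1 : wsq (2 - γ) (iteratedDeriv 1 h) = ∫ θ in Ioo 0 (π / 2), iteratedDeriv 1 h θ ^ 2 * Real.sin (2 * θ) ^ ((((2 * 1 : ℕ)) : ℝ) - γ) := by
    unfold wsq; norm_num
  have w2 : wsq (4 - γ) (iteratedDeriv 2 h) = ∫ θ in Ioo 0 (π / 2), iteratedDeriv 2 h θ ^ 2 * Real.sin (2 * θ) ^ ((((2 * 2 : ℕ)) : ℝ) - γ) := by
    unfold wsq; norm_num
  have w3 : wsq (6 - γ) (iteratedDeriv 3 h) = ∫ θ in Ioo 0 (π / 2), iteratedDeriv 3 h θ ^ 2 * Real.sin (2 * θ) ^ ((((2 * 3 : ℕ)) : ℝ) - γ) := by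
    unfold wsq; norm_num
  have w4 : wsq (8 - γ) (iteratedDeriv 4 h) = ∫ θ in Ioo 0 (π / 2), iteratedDeriv 4 h θ ^ 2 * Real.sin (2 * θ) ^ ((((2 * 4 : ℕ)) : ℝ) - γ) := by
    unfold wsq; norm_num
  have n1 : 0 ≤ ∫ θ in Ioo 0 (π / 2), B 1 θ := setIntegral_nonneg measurableSet_Ioo (hBn 1)
  have n2 : 0 ≤ ∫ θ in Ioo 0 (π / 2), B 2 θ := setIntegral_nonneg measurableSet_Ioo (hBn 2)
  have n3 : 0 ≤ ∫ θ in Ioo 0 (π / 2), B 3 θ := setIntegral_nonneg measurableSet_Ioo (hBn 3)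
  have n4 : 0 ≤ ∫ θ in Ioo 0 (π / 2), B 4 θ := setIntegral_nonneg measurableSet_Ioo (hBn 4)
  have b1 := h1.2; have b2 := h2.2; have b3 := h3.2; have b4 := h4.2
  rw [e2] at b2; rw [e3] at b3; rw [e4] at b4
  rw [w1, w2, w3, w4, hBw 1, hBw 2, hBw 3, hBw 4]
  exact ⟨by linarith, by linarith, by linarith, by linarith⟩

/-- The lower-order integrand `g²S^{−η}` is integrable for continuous `g`. [folklore] -/
theorem integrableOn_sq_mul_sin_rpow_neg_eta {g : ℝ → ℝ} (hg : Continuous g) :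
    IntegrableOn (fun θ => g θ ^ 2 * Real.sin (2 * θ) ^ (-eta)) (Ioo 0 (π / 2)) :=
  integrableOn_sq_mul_rpow eta_pos.le (by norm_num [eta]) hg

/-- **The levels `k = 1, …, 4` of Lemma 8.23 combined**: for `g ∈ C^∞(ℝ)`, `f = sin 2θ·g`, `1 < γ < 2`,
`Σ_{m=1}^4 ∫(g⁽ᵐ⁾)²S^{2m−γ} ≤ 3·10¹⁹·(Σ_{m=1}^4 ∫(f⁽ᵐ⁺¹⁾)²S^{2m−γ} + ∫g²S^{−η})`. [cite: Elgindi2021, §8.5 Lemma 8.23 and proof of Proposition 8.21 (pp. 28–29 of arXiv:1904.04795)] -/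
theorem wsq_iteratedDeriv_levels_le {γ : ℝ} (hγ1 : 1 < γ) (hγ2 : γ < 2) {g : ℝ → ℝ} (hg : ContDiff ℝ ∞ g) :
    wsq (2 - γ) (iteratedDeriv 1 g) ≤ 3 * 10 ^ 19 * (wsq (2 - γ) (iteratedDeriv 2 fun x => Real.sin (2 * x) * g x) + wsq (-eta) g) ∧
    wsq (2 - γ) (iteratedDeriv 1 g) + wsq (4 - γ) (iteratedDeriv 2 g) ≤
      3 * 10 ^ 19 * (wsq (2 - γ) (iteratedDeriv 2 fun x => Real.sin (2 * x) * g x) +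
        wsq (4 - γ) (iteratedDeriv 3 fun x => Real.sin (2 * x) * g x) + wsq (-eta) g) ∧
    wsq (2 - γ) (iteratedDeriv 1 g) + wsq (4 - γ) (iteratedDeriv 2 g) + wsq (6 - γ) (iteratedDeriv 3 g) ≤
      3 * 10 ^ 19 * (wsq (2 - γ) (iteratedDeriv 2 fun x => Real.sin (2 * x) * g x) +
        wsq (4 - γ) (iteratedDeriv 3 fun x => Real.sin (2 * x) * g x) + wsq (6 - γ) (iteratedDeriv 4 fun x => Real.sin (2 * x) * g x) +
        wsq (-eta) g) ∧
    wsq (2 - γ) (iteratedDeriv 1 g) + wsq (4 - γ) (iteratedDeriv 2 g) + wsq (6 - γ) (iteratedDeriv 3 g) + wsq (8 - γ) (iteratedDeriv 4 g) ≤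
      3 * 10 ^ 19 * (wsq (2 - γ) (iteratedDeriv 2 fun x => Real.sin (2 * x) * g x) +
        wsq (4 - γ) (iteratedDeriv 3 fun x => Real.sin (2 * x) * g x) + wsq (6 - γ) (iteratedDeriv 4 fun x => Real.sin (2 * x) * g x) +
        wsq (8 - γ) (iteratedDeriv 5 fun x => Real.sin (2 * x) * g x) + wsq (-eta) g) := by
  have hη : eta = 99 / 100 := rfl
  have l1 := wsq_iteratedDeriv_le (k := 1) le_rfl hγ1 hγ2 hg
  have l2 := wsq_iteratedDeriv_le (k := 2) (by norm_num) hγ1 hγ2 hg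
  have l3 := wsq_iteratedDeriv_le (k := 3) (by norm_num) hγ1 hγ2 hg
  have l4 := wsq_iteratedDeriv_le (k := 4) (by norm_num) hγ1 hγ2 hg
  simp only [Finset.sum_range_succ, Finset.sum_range_zero, zero_add, iteratedDeriv_zero] at l1 l2 l3 l4
  norm_num [-iteratedDeriv_one] at l1 l2 l3 l4
  -- monotonicity in the exponent
  have hc : ∀ m, Continuous (iteratedDeriv m g) := fun m => hg.continuous_iteratedDeriv m (natCast_le_infty _)
  have mono : ∀ {q q' : ℝ} (m : ℕ), q' ≤ q → 0 ≤ q' → wsq q (iteratedDeriv m g) ≤ wsq q' (iteratedDeriv m g) := fun m hqq hq' =>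
    wsq_mono_exponent hqq (hc m) (integrableOn_sq_mul_sin_rpow hq' (hc m))
  have mono0 : ∀ {q : ℝ}, -eta ≤ q → wsq q g ≤ wsq (-eta) g := fun hq =>
    wsq_mono_exponent hq hg.continuous (integrableOn_sq_mul_sin_rpow_neg_eta hg.continuous)
  have a2 : wsq (4 - γ) g ≤ wsq (-eta) g := mono0 (by rw [hη]; linarith)
  have a3 : wsq (6 - γ) g ≤ wsq (-eta) g := mono0 (by rw [hη]; linarith)
  have a4 : wsq (8 - γ) g ≤ wsq (-eta) g := mono0 (by rw [hη]; linarith)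
  have a1 : wsq (2 - γ) g ≤ wsq (-eta) g := mono0 (by rw [hη]; linarith)
  have m21 : wsq (4 - γ) (iteratedDeriv 1 g) ≤ wsq (2 - γ) (iteratedDeriv 1 g) := mono 1 (by linarith) (by linarith)
  have m31 : wsq (6 - γ) (iteratedDeriv 1 g) ≤ wsq (2 - γ) (iteratedDeriv 1 g) := mono 1 (by linarith) (by linarith)
  have m32 : wsq (6 - γ) (iteratedDeriv 2 g) ≤ wsq (4 - γ) (iteratedDeriv 2 g) := mono 2 (by linarith) (by linarith)
  have m41 : wsq (8 - γ) (iteratedDeriv 1 g) ≤ wsq (2 - γ) (iteratedDeriv 1 g) := mono 1 (by linarith) (by linarith)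
  have m42 : wsq (8 - γ) (iteratedDeriv 2 g) ≤ wsq (4 - γ) (iteratedDeriv 2 g) := mono 2 (by linarith) (by linarith)
  have m43 : wsq (8 - γ) (iteratedDeriv 3 g) ≤ wsq (6 - γ) (iteratedDeriv 3 g) := mono 3 (by linarith) (by linarith)
  have n0 := wsq_nonneg (-eta) g
  have nY1 := wsq_nonneg (2 - γ) (iteratedDeriv 2 fun x => Real.sin (2 * x) * g x)
  have nY2 := wsq_nonneg (4 - γ) (iteratedDeriv 3 fun x => Real.sin (2 * x) * g x)
  have nY3 := wsq_nonneg (6 - γ) (iteratedDeriv 4 fun x => Real.sin (2 * x) * g x)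
  have nY4 := wsq_nonneg (8 - γ) (iteratedDeriv 5 fun x => Real.sin (2 * x) * g x)
  have nT1 := wsq_nonneg (2 - γ) (iteratedDeriv 1 g)
  have nT2 := wsq_nonneg (4 - γ) (iteratedDeriv 2 g)
  have nT3 := wsq_nonneg (6 - γ) (iteratedDeriv 3 g)
  exact ⟨by linarith, by linarith, by linarith, by linarith⟩


/-! ### Proposition 8.21: the one-variable core -/

/-- **Level zero** (the sharp Hardy inequality): `∫g²S^{−η} ≤ ∫f′²S^{−η}` for `f = sin 2θ·g`,
`g ∈ C^∞(ℝ)`. [cite: Elgindi2021, §7.2 Corollary 7.6 and §8.5 Proposition 8.21 (pp. 20, 28 of arXiv:1904.04795)] -/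
theorem wsq_neg_eta_le {g : ℝ → ℝ} (hg : ContDiff ℝ ∞ g) :
    wsq (-eta) g ≤ wsq (-eta) (deriv fun x => Real.sin (2 * x) * g x) := by
  set f : ℝ → ℝ := fun x => Real.sin (2 * x) * g x with hf
  have hfs : ContDiff ℝ ∞ f := contDiff_sin_two_mul.mul hg
  have hf1 : ContDiff ℝ 1 f := hfs.of_le one_le_infty
  have h0 : f 0 = 0 := by simp [hf]
  have h1 : f (π / 2) = 0 := by simp only [hf, show 2 * (π / 2) = π by ring, Real.sin_pi, zero_mul]
  have hH := sharpHardy_sin_two_mul' eta_pos.le (by norm_num [eta]) hf1 h0 h1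
  have e : wsq (-eta) g = ∫ θ in Ioo 0 (π / 2), (f θ / Real.sin (2 * θ)) ^ 2 * Real.sin (2 * θ) ^ (-eta) :=
    wsq_congr fun θ hθ => by
      simp only [hf]; rw [mul_div_cancel_left₀ _ (sin_two_mul_pos_of_mem hθ).ne']
  rw [e]
  refine hH.trans ?_
  have hn : 0 ≤ ∫ θ in Ioo 0 (π / 2), deriv f θ ^ 2 * Real.sin (2 * θ) ^ (-eta) := wsq_nonneg (-eta) (deriv f)
  have hc : 1 / (eta + 1) ^ 2 ≤ 1 := by norm_num [eta]
  calc 1 / (eta + 1) ^ 2 * ∫ θ in Ioo 0 (π / 2), deriv f θ ^ 2 * Real.sin (2 * θ) ^ (-eta)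
      ≤ 1 * ∫ θ in Ioo 0 (π / 2), deriv f θ ^ 2 * Real.sin (2 * θ) ^ (-eta) := mul_le_mul_of_nonneg_right hc hn
    _ = wsq (-eta) (deriv f) := by rw [one_mul]; rfl

/-- **Proposition 8.21 of [Elgindi2021], one-variable core**: for `1 < γ ≤ 11/10`, `g ∈ C^∞(ℝ)`,
`f = sin 2θ·g` (so `g = f/sin 2θ` on `(0, π/2)`, `f(0) = f(π/2) = 0`) and every `n ≤ 4`,
`Σ_{i=1}^n ∫_{(0,π/2)} (D_θⁱ g)² S^{−γ} ≤ 10³⁰·(Σ_{i=1}^n ∫ (D_θⁱ f′)² S^{−γ} + ∫ f′² S^{−η})`,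
`D_θ = sin 2θ·∂_θ`, `S = sin 2θ`, `η = 99/100` — the angular part of `|f/sin 2θ|_{𝓗⁴} ≤ C|∂_θf|_{𝓗⁴}`
(the truncations `n < 4` serve the words `D_θⁱD_zʲ` with `i + j ≤ 4`); the radial part is the
level-zero inequality `wsq_neg_eta_le`. [cite: Elgindi2021, §8.5 Proposition 8.21 with Lemma 8.23 (pp. 28–29 of arXiv:1904.04795)] -/
theorem divisionBySin_core {γ : ℝ} (hγ1 : 1 < γ) (hγ2 : γ ≤ 11 / 10) {g : ℝ → ℝ} (hg : ContDiff ℝ ∞ g) {n : ℕ} (hn : n ≤ 4) :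
    (∑ i ∈ range n, wsq (-γ) (Dθ₁^[i + 1] g)) ≤
      10 ^ 30 * ((∑ i ∈ range n, wsq (-γ) (Dθ₁^[i + 1] (deriv fun x => Real.sin (2 * x) * g x))) +
        wsq (-eta) (deriv fun x => Real.sin (2 * x) * g x)) := by
  have hγ2' : γ < 2 := by linarith
  set f : ℝ → ℝ := fun x => Real.sin (2 * x) * g x with hf
  have hfs : ContDiff ℝ ∞ f := contDiff_sin_two_mul.mul hg
  have hds : ContDiff ℝ ∞ (deriv f) := hfs.deriv'
  obtain ⟨-, u1, u2, u3, u4⟩ := wsq_iterate_Dθ₁_le hγ2' hg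
  obtain ⟨v1, v2, v3, v4⟩ := wsq_iteratedDeriv_levels_le hγ1 hγ2' hg
  obtain ⟨d1, d2, d3, d4⟩ := wsq_iteratedDeriv_le_wsq_iterate_Dθ₁ hγ2' hds
  have l0 := wsq_neg_eta_le hg
  have e2 : iteratedDeriv 2 f = iteratedDeriv 1 (deriv f) := iteratedDeriv_succ'
  have e3 : iteratedDeriv 3 f = iteratedDeriv 2 (deriv f) := iteratedDeriv_succ'
  have e4 : iteratedDeriv 4 f = iteratedDeriv 3 (deriv f) := iteratedDeriv_succ'
  have e5 : iteratedDeriv 5 f = iteratedDeriv 4 (deriv f) := iteratedDeriv_succ'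
  rw [e2] at v1 v2 v3 v4; rw [e3] at v2 v3 v4; rw [e4] at v3 v4; rw [e5] at v4
  have n0 := wsq_nonneg (-eta) (deriv f)
  have n1 := wsq_nonneg (-γ) (Dθ₁^[1] (deriv f))
  have n2 := wsq_nonneg (-γ) (Dθ₁^[2] (deriv f))
  have n3 := wsq_nonneg (-γ) (Dθ₁^[3] (deriv f))
  have n4 := wsq_nonneg (-γ) (Dθ₁^[4] (deriv f))
  have m1 := wsq_nonneg (2 - γ) (iteratedDeriv 1 (deriv f))
  have m2 := wsq_nonneg (4 - γ) (iteratedDeriv 2 (deriv f))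
  have m3 := wsq_nonneg (6 - γ) (iteratedDeriv 3 (deriv f))
  have m4 := wsq_nonneg (8 - γ) (iteratedDeriv 4 (deriv f))
  have k0 := wsq_nonneg (-eta) g
  interval_cases n <;> simp only [Finset.sum_range_succ, Finset.sum_range_zero, zero_add] <;> nlinarith


end Elgindi

end Literature.Analysis.FluidPDE
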